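import Summits.QuantumAdvantage.QuantumAdvantage.Theorems.WalkThreeStepFarReadInputs

/-!
# Rung (G♯₂) `ThreeStepFreeRungFive` (item stmt-QuantumAdvantage-23286), architecture (U), the FAR-READ LEMMA 4/6: the scene, the
# line witness, CLAIM 1 (where the double readers sit) and the isolation of the far cluster

Cell qa-qnc0, route OddPrimeWalk, support item stmt-QuantumAdvantage-23286; prover qn-prover-3 g17.

§1 `Scene`: a register-symmetric position `π` with room `64` on both sides whose observers sit in `(90, n − 90)`, and a cut `hq` at a
far position `h` (`|h − π| ≥ 128`) reading `π` effectively and NON-CONSTANT.  (The far-read lemma says no scene exists once `h` is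
extremal; files 5/6–6/6.)  §2 the LINE WITNESS: a double reader of `{π, h}` has `c = 1` at some indicator input of any admissible
family `P₀ ∪ [β, β+j)` (`line_witness`).  §3 **CLAIM 1** (`Scene.pos_of_mem_pairSet`): every member of `pairSet` sits at
`π, π±1, h, h±1, ρ_h, ρ_π` (`ρ_h` = the other read of `hq`, `ρ_π` = the other read of the cut at `π`) — any other member is positioned at
an unread position, is killed by the transposition there, and the line witness contradicts the kill.  §4 ISOLATION: a clean zone of
nine positions next to `π` on `h`'s side (`exists_clean_zone_up/down`) splits the four-term sum; the part on `h`'s side vanishes on its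
own (`Scene.far_sum_eq_zero_up/down`).
WHAT THIS IS NOT: the final contradiction is in files 5/6–6/6; separation NOT moved.
-/

namespace Summit.QuantumAdvantage.AdviceFreeQNC0.LocalEngine

open Finset Classical

namespace RungU

variable {n : ℕ}

/-! ### §1 The scene -/

/-- A SCENE: symmetric `π` with room and well-placed observers, and a far non-constant cut `hq` at `h` reading `π` effectively. -/
structure Scene (n : ℕ) where
  /-- the strategy -/
  S : ThreeStep 5 n
  /-- the symmetric position -/
  π : ℕ
  /-- the far position -/
  h : ℕ
  /-- the cut at the far position -/
  hq : Fin (n + 1)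
  hq_val : hq.val = h
  sym : ∀ y : Fin n → Bool, reg S (cornerFlip n π y) = reg S y
  reads : cf S hq π ≠ 0
  nonconst : ¬ IsConst S hq
  room : 64 ≤ π ∧ π + 64 ≤ n
  obsPos : ∀ q : Fin (n + 1), Observes S q π → 90 < q.val ∧ q.val + 90 < n
  far : π + 128 ≤ h ∨ h + 128 ≤ π

namespace Scene

variable (sc : Scene n)

/-- the cut positioned at `π`. -/
def πq : Fin (n + 1) := ⟨sc.π, by have := sc.room; omega⟩

/-- its position. -/
theorem πq_val : sc.πq.val = sc.π := rfl

/-- the other read of the far cut. -/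
def ρh : ℕ := otherRead sc.S sc.hq sc.π

/-- the other read of the cut at `π` (relative to `h`). -/
def ρπ : ℕ := otherRead sc.S sc.πq sc.h

/-- position bounds of the far cut. -/
theorem h_bounds : 90 < sc.h ∧ sc.h + 90 < n := by
  have := sc.obsPos sc.hq (observes_of_cf sc.S sc.hq sc.π sc.reads)
  rw [sc.hq_val] at this
  exact this

/-- `|π − h| ≥ 2` in the form the pair lemmas want. -/
theorem πh2 : sc.π + 2 ≤ sc.h ∨ sc.h + 2 ≤ sc.π := by have := sc.far; omega

/-- a cut reading `π` effectively sits in `(90, n − 90)`. -/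
theorem pos_of_cf (q : Fin (n + 1)) (hq : cf sc.S q sc.π ≠ 0) : 90 < q.val ∧ q.val + 90 < n :=
  sc.obsPos q (observes_of_cf sc.S q sc.π hq)

/-- the far cut is the member of `pairSet` at `h`. -/
theorem hq_mem : sc.hq ∈ pairSet sc.S sc.π sc.h :=
  mem_pairSet.mpr ⟨Or.inr sc.reads, Or.inl sc.hq_val⟩

/-- a member positioned at `h` is the far cut. -/
theorem eq_hq_of_val {q : Fin (n + 1)} (hq : q.val = sc.h) : q = sc.hq := Fin.ext (hq.trans sc.hq_val.symm)

/-- a member positioned at `π` is `πq`. -/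
theorem eq_πq_of_val {q : Fin (n + 1)} (hq : q.val = sc.π) : q = sc.πq := Fin.ext hq

/-- **reads of a member of `pairSet`** lie in `{π, h, ρ_h, ρ_π}`. -/
theorem read_of_mem {q : Fin (n + 1)} (hq : q ∈ pairSet sc.S sc.π sc.h) {r : ℕ} (hr : cf sc.S q r ≠ 0) :
    r = sc.π ∨ r = sc.h ∨ r = sc.ρh ∨ r = sc.ρπ := by
  rw [mem_pairSet] at hq
  obtain ⟨h1, h2⟩ := hq
  have hne : sc.π ≠ sc.h := by have := sc.far; omega
  rcases h1 with h1 | h1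
  · -- positioned at π: reads h and ρπ
    have hqπ : q = sc.πq := sc.eq_πq_of_val h1
    rcases h2 with h2 | h2
    · exact absurd (h1.symm.trans h2) hne
    · subst hqπ
      rcases read_eq_of_cf sc.S sc.πq h2 hr with e | e
      · exact Or.inr (Or.inl e)
      · exact Or.inr (Or.inr (Or.inr e))
  · rcases h2 with h2 | h2
    · have hqh : q = sc.hq := sc.eq_hq_of_val h2
      subst hqh
      rcases read_eq_of_cf sc.S sc.hq h1 hr with e | e
      · exact Or.inl e
      · exact Or.inr (Or.inr (Or.inl e))
    · rcases read_eq_of_cf sc.S q h1 hr with e | e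
      · exact Or.inl e
      · -- the other read of q relative to π is h
        rcases read_eq_of_cf sc.S q h1 h2 with e' | e'
        · exact absurd e'.symm hne
        · exact Or.inr (Or.inl (e.trans e'.symm))

end Scene

/-! ### §2 The line witness -/

/-- the block contribution `min (β + j) r − β` below a far-away read: `j` if the block is below `r`, `0` if above. -/
theorem block_below (β j r : ℕ) (h : β + j ≤ r) : min (β + j) r - β = j := by
  rw [min_eq_left h]; omega

/-- (companion of `block_below`) -/
theorem block_above (β j r : ℕ) (h : r ≤ β) : min (β + j) r - β = 0 := by
  have : min (β + j) r ≤ β := (min_le_right _ _).trans h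
  omega

/-- **LINE WITNESS.**  A cut `q` reading `π` and `h` (far apart) effectively, a base set `P₀ ⊆ [0,n)` with the `10`-patterns at `π` and
`h`, and three admissible five-blocks (below both, between, above both, disjoint from `P₀`): along one of the three block families the
four-fold difference `c` of `q` takes the value `1`. -/
theorem line_witness (S : ThreeStep 5 n) {π h : ℕ} (hπh : π + 2 ≤ h ∨ h + 2 ≤ π) (hπ1 : 1 ≤ π) (hπn : π < n) (hh1 : 1 ≤ h)
    (hhn : h < n) (q : Fin (n + 1)) (hqπ : cf S q π ≠ 0) (hqh : cf S q h ≠ 0)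
    (P₀ : Finset ℕ) (hP₀ : ∀ j ∈ P₀, j < n) (tπ : π - 1 ∈ P₀ ∧ π ∉ P₀) (th : h - 1 ∈ P₀ ∧ h ∉ P₀)
    (βA βB βC : ℕ) (hA : βA + 5 < π ∧ βA + 5 < h) (hB : (π < βB ∧ βB + 5 < h) ∨ (h < βB ∧ βB + 5 < π))
    (hC : π < βC ∧ h < βC ∧ βC + 5 ≤ n)
    (hdis : ∀ i ∈ P₀, ¬ (βA ≤ i ∧ i < βA + 5) ∧ ¬ (βB ≤ i ∧ i < βB + 5) ∧ ¬ (βC ≤ i ∧ i < βC + 5)) :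
    ∃ β : ℕ, (β = βA ∨ β = βB ∨ β = βC) ∧ ∃ j : ℕ, j < 5 ∧
      c4 S π h (indic (P₀ ∪ Ico β (β + j)) : Fin n → Bool) q = true := by
  set a := cf S q π with ha
  set b := cf S q h with hb
  set γ := S.γ q with hγ
  -- the coefficient of a block: how much the line value moves per added one
  have key : ∀ β : ℕ, (β = βA ∨ β = βB ∨ β = βC) → (β + 5 ≤ π ∨ π ≤ β) → (β + 5 ≤ h ∨ h ≤ β) → β + 5 ≤ n →
      (∀ i ∈ P₀, ¬ (β ≤ i ∧ i < β + 5)) →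
      (a * (if β + 5 ≤ π then 1 else 0) + b * (if β + 5 ≤ h then 1 else 0) + γ ≠ 0) →
      ∃ β' : ℕ, (β' = βA ∨ β' = βB ∨ β' = βC) ∧ ∃ j : ℕ, j < 5 ∧
        c4 S π h (indic (P₀ ∪ Ico β' (β' + j)) : Fin n → Bool) q = true := by
    intro β hβ hβπ hβh hβn hβdis hκ
    refine ⟨β, hβ, ?_⟩
    set κ := a * (if β + 5 ≤ π then 1 else 0) + b * (if β + 5 ≤ h then 1 else 0) + γ with hκdef
    -- the family
    have hPj : ∀ j, j < 5 → ∀ i ∈ P₀ ∪ Ico β (β + j), i < n := by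
      intro j hj i hi
      rw [Finset.mem_union, Finset.mem_Ico] at hi
      rcases hi with hi | hi
      · exact hP₀ i hi
      · omega
    have hdisj : ∀ j, j < 5 → ∀ i ∈ P₀, ¬ (β ≤ i ∧ i < β + j) := fun j hj i hi hh => hβdis i hi ⟨hh.1, by omega⟩
    have tenπ : ∀ j, j < 5 → Ten (indic (P₀ ∪ Ico β (β + j)) : Fin n → Bool) π := by
      intro j hj
      apply ten_indic _ hπ1
      · exact Finset.mem_union_left _ tπ.1
      · rw [Finset.mem_union, Finset.mem_Ico, not_or]; exact ⟨tπ.2, by omega⟩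
    have tenh : ∀ j, j < 5 → Ten (indic (P₀ ∪ Ico β (β + j)) : Fin n → Bool) h := by
      intro j hj
      apply ten_indic _ hh1
      · exact Finset.mem_union_left _ th.1
      · rw [Finset.mem_union, Finset.mem_Ico, not_or]; exact ⟨th.2, by omega⟩
    -- prefix counts along the family
    have Nπ : ∀ j, j < 5 → ((wtPrefix (indic (P₀ ∪ Ico β (β + j)) : Fin n → Bool) π : ℕ) : ZMod 5)
        = ((wtPrefix (indic P₀ : Fin n → Bool) π : ℕ) : ZMod 5) + (if β + 5 ≤ π then 1 else 0) * (j : ℕ) := by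
      intro j hj
      rw [wtPrefix_indic_union_Ico P₀ hP₀ β j (by omega) (hdisj j hj) π]
      rcases hβπ with h1 | h1
      · rw [block_below β j π (by omega), if_pos h1]; push_cast; ring
      · rw [block_above β j π h1, if_neg (by omega)]; push_cast; ring
    have Nh : ∀ j, j < 5 → ((wtPrefix (indic (P₀ ∪ Ico β (β + j)) : Fin n → Bool) h : ℕ) : ZMod 5)
        = ((wtPrefix (indic P₀ : Fin n → Bool) h : ℕ) : ZMod 5) + (if β + 5 ≤ h then 1 else 0) * (j : ℕ) := by
      intro j hj
      rw [wtPrefix_indic_union_Ico P₀ hP₀ β j (by omega) (hdisj j hj) h]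
      rcases hβh with h1 | h1
      · rw [block_below β j h (by omega), if_pos h1]; push_cast; ring
      · rw [block_above β j h h1, if_neg (by omega)]; push_cast; ring
    have Nw : ∀ j, j < 5 → ((wt (indic (P₀ ∪ Ico β (β + j)) : Fin n → Bool) : ℕ) : ZMod 5)
        = ((wt (indic P₀ : Fin n → Bool) : ℕ) : ZMod 5) + (j : ℕ) := by
      intro j hj
      rw [wt_indic_union_Ico P₀ hP₀ β j (by omega) (hdisj j hj)]
      push_cast; ring
    obtain ⟨j, hj, hc⟩ := exists_cfun_true a b γ (S.r q) hqπ hqh κ hκ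
      (fun j => ((wtPrefix (indic (P₀ ∪ Ico β (β + j)) : Fin n → Bool) π : ℕ) : ZMod 5))
      (fun j => ((wtPrefix (indic (P₀ ∪ Ico β (β + j)) : Fin n → Bool) h : ℕ) : ZMod 5))
      (fun j => ((wt (indic (P₀ ∪ Ico β (β + j)) : Fin n → Bool) : ℕ) : ZMod 5))
      (a * ((wtPrefix (indic P₀ : Fin n → Bool) π : ℕ) : ZMod 5) + b * ((wtPrefix (indic P₀ : Fin n → Bool) h : ℕ) : ZMod 5)
        + γ * ((wt (indic P₀ : Fin n → Bool) : ℕ) : ZMod 5))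
      (fun j hj => by simp only [Nπ j hj, Nh j hj, Nw j hj, hκdef]; ring)
    refine ⟨j, hj, ?_⟩
    rw [c4_eq_cfun S q hπh hqπ hqh hπ1 hπn hh1 hhn (tenπ j hj) (tenh j hj)]
    exact hc
  -- which block has a non-zero coefficient
  by_cases hCκ : a * (if βC + 5 ≤ π then 1 else 0) + b * (if βC + 5 ≤ h then 1 else 0) + γ ≠ 0
  · exact key βC (Or.inr (Or.inr rfl)) (Or.inr hC.1.le) (Or.inr hC.2.1.le) hC.2.2 (fun i hi => (hdis i hi).2.2) hCκ
  · have hγ0 : γ = 0 := by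
      rw [if_neg (by omega), if_neg (by omega)] at hCκ
      simpa using hCκ
    by_cases hBκ : a * (if βB + 5 ≤ π then 1 else 0) + b * (if βB + 5 ≤ h then 1 else 0) + γ ≠ 0
    · rcases hB with hB | hB
      · exact key βB (Or.inr (Or.inl rfl)) (Or.inr hB.1.le) (Or.inl (by omega)) (by omega) (fun i hi => (hdis i hi).2.1) hBκ
      · exact key βB (Or.inr (Or.inl rfl)) (Or.inl (by omega)) (Or.inr hB.1.le) (by omega) (fun i hi => (hdis i hi).2.1) hBκ
    · exfalso
      rcases hB with hB | hB
      · rw [if_neg (by omega), if_pos (by omega), hγ0] at hBκ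
        apply hqh; simpa using hBκ
      · rw [if_pos (by omega), if_neg (by omega), hγ0] at hBκ
        apply hqπ; simpa using hBκ

/-! ### §3 CLAIM 1: where the members of `pairSet` sit -/

namespace Scene

variable (sc : Scene n)

/-- no member of `pairSet` reads a position outside `{π, h, ρ_h, ρ_π}`. -/
theorem cf_eq_zero_of_mem {q : Fin (n + 1)} (hq : q ∈ pairSet sc.S sc.π sc.h) {k : ℕ}
    (h1 : k ≠ sc.π) (h2 : k ≠ sc.h) (h3 : k ≠ sc.ρh) (h4 : k ≠ sc.ρπ) : cf sc.S q k = 0 := by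
  by_contra hc
  rcases sc.read_of_mem hq hc with e | e | e | e
  · exact h1 e
  · exact h2 e
  · exact h3 e
  · exact h4 e

/-- a member at an UNREAD position (not `π, π±1, h, h±1, ρ_h, ρ_π`) has vanishing four-fold difference at every input with `10` there. -/
theorem c4_eq_false_of_unread {q : Fin (n + 1)} (hq : q ∈ pairSet sc.S sc.π sc.h)
    (hpos : q.val ≠ sc.π ∧ q.val ≠ sc.π - 1 ∧ q.val ≠ sc.π + 1 ∧ q.val ≠ sc.h ∧ q.val ≠ sc.h - 1 ∧ q.val ≠ sc.h + 1 ∧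
      q.val ≠ sc.ρh ∧ q.val ≠ sc.ρπ)
    {x : Fin n → Bool} (hx : Ten x q.val) : c4 sc.S sc.π sc.h x q = false := by
  have hqπ : cf sc.S q sc.π ≠ 0 := by
    have := (mem_pairSet.mp hq).1; rcases this with e | e
    · exact absurd e hpos.1
    · exact e
  have hb := sc.pos_of_cf q hqπ
  have hkill := fourTerm_eq_zero_of_unread sc.S sc.πh2 (k := q.val) (by omega) (by omega) (by omega) (by omega) sc.sym
    (Finset.Subset.refl _) q hq rfl (fun q' hq' => sc.cf_eq_zero_of_mem hq' hpos.1 hpos.2.2.2.1 hpos.2.2.2.2.2.2.1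
      hpos.2.2.2.2.2.2.2) hx
  rw [fourTerm_eq_c4 sc.S sc.π sc.h x q hpos.1 hpos.2.2.2.1] at hkill
  exact (bt_eq_zero _).mp (eq_zero_of_rotZ _ _ hkill)

/-- **CLAIM 1**: every member of `pairSet` sits at `π`, `π ± 1`, `h`, `h ± 1`, `ρ_h` or `ρ_π`. -/
theorem pos_of_mem_pairSet {q : Fin (n + 1)} (hq : q ∈ pairSet sc.S sc.π sc.h) :
    q.val = sc.π ∨ q.val = sc.π - 1 ∨ q.val = sc.π + 1 ∨ q.val = sc.h ∨ q.val = sc.h - 1 ∨ q.val = sc.h + 1 ∨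
      q.val = sc.ρh ∨ q.val = sc.ρπ := by
  by_contra hne
  push Not at hne
  obtain ⟨n1, n2, n3, n4, n5, n6, n7, n8⟩ := hne
  have hqπ : cf sc.S q sc.π ≠ 0 := by
    have := (mem_pairSet.mp hq).1; rcases this with e | e
    · exact absurd e n1
    · exact e
  have hqh : cf sc.S q sc.h ≠ 0 := by
    have := (mem_pairSet.mp hq).2; rcases this with e | e
    · exact absurd e n4
    · exact e
  have hb := sc.pos_of_cf q hqπ
  have hr := sc.room
  have hh := sc.h_bounds
  have hfar := sc.far
  -- the witness family: base {π-1, h-1, q-1}, blocks avoiding the pattern bits of q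
  set P₀ : Finset ℕ := {sc.π - 1, sc.h - 1, q.val - 1} with hP₀
  have hP₀n : ∀ j ∈ P₀, j < n := by
    intro j hj
    simp only [hP₀, Finset.mem_insert, Finset.mem_singleton] at hj
    omega
  have memP₀ : ∀ j, j ∈ P₀ ↔ (j = sc.π - 1 ∨ j = sc.h - 1 ∨ j = q.val - 1) := by
    intro j; simp only [hP₀, Finset.mem_insert, Finset.mem_singleton]
  -- block positions
  set ℓ := min sc.π sc.h with hℓ
  set u := max sc.π sc.h with hu
  set βB := (if q.val ≤ ℓ + 7 then ℓ + 9 else ℓ + 1) with hβB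
  set βC := (if q.val ≤ u + 7 then u + 9 else u + 1) with hβC
  have hβB' : (sc.π < βB ∧ βB + 5 < sc.h) ∨ (sc.h < βB ∧ βB + 5 < sc.π) := by
    rw [hβB, hℓ]
    rcases hfar with hf | hf
    · left; rw [min_eq_left (by omega)]; split_ifs <;> omega
    · right; rw [min_eq_right (by omega)]; split_ifs <;> omega
  have hβC' : sc.π < βC ∧ sc.h < βC ∧ βC + 5 ≤ n := by
    rw [hβC, hu]
    rcases le_total sc.π sc.h with hle | hle
    · rw [max_eq_right hle]; split_ifs <;> omega
    · rw [max_eq_left hle]; split_ifs <;> omega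
  obtain ⟨β, hβ, j, hj, hc⟩ := line_witness sc.S sc.πh2 (by omega) (by omega) (by omega) (by omega) q hqπ hqh P₀ hP₀n
    ⟨(memP₀ _).mpr (Or.inl rfl), fun hm => by rw [memP₀] at hm; omega⟩
    ⟨(memP₀ _).mpr (Or.inr (Or.inl rfl)), fun hm => by rw [memP₀] at hm; omega⟩
    0 βB βC ⟨by omega, by omega⟩ hβB' hβC'
    (by
      intro i hi
      rw [memP₀] at hi
      refine ⟨by omega, ?_, ?_⟩
      · rw [hβB, hℓ]
        rcases le_total sc.π sc.h with hle | hle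
        · rw [min_eq_left hle]; split_ifs <;> omega
        · rw [min_eq_right hle]; split_ifs <;> omega
      · rw [hβC, hu]
        rcases le_total sc.π sc.h with hle | hle
        · rw [max_eq_right hle]; split_ifs <;> omega
        · rw [max_eq_left hle]; split_ifs <;> omega)
  -- the witness input has the pattern at q, so its c vanishes: contradiction
  have hten : Ten (indic (P₀ ∪ Ico β (β + j)) : Fin n → Bool) q.val := by
    apply ten_indic _ (by omega)
    · exact Finset.mem_union_left _ ((memP₀ _).mpr (Or.inr (Or.inr rfl)))
    · rw [Finset.mem_union, memP₀, Finset.mem_Ico, not_or]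
      refine ⟨by omega, ?_⟩
      rcases hβ with rfl | rfl | rfl
      · omega
      · rw [hβB, hℓ]
        rcases le_total sc.π sc.h with hle | hle
        · rw [min_eq_left hle]; split_ifs <;> omega
        · rw [min_eq_right hle]; split_ifs <;> omega
      · rw [hβC, hu]
        rcases le_total sc.π sc.h with hle | hle
        · rw [max_eq_right hle]; split_ifs <;> omega
        · rw [max_eq_left hle]; split_ifs <;> omega
  have h0 := sc.c4_eq_false_of_unread hq ⟨n1, n2, n3, n4, n5, n6, n7, n8⟩ hten
  rw [h0] at hc
  exact Bool.false_ne_true hc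

/-! ### §4 Isolation of the far cluster -/

/-- three candidate zones next to `π` on the upper side: one avoids both extra read points. -/
theorem exists_clean_zone_up (π r₁ r₂ : ℕ) :
    ∃ z : ℕ, (z = π + 2 ∨ z = π + 12 ∨ z = π + 22) ∧ ¬ (z < r₁ ∧ r₁ < z + 9) ∧ ¬ (z < r₂ ∧ r₂ < z + 9) := by
  by_cases h1 : ¬ (π + 2 < r₁ ∧ r₁ < π + 2 + 9) ∧ ¬ (π + 2 < r₂ ∧ r₂ < π + 2 + 9)
  · exact ⟨π + 2, Or.inl rfl, h1.1, h1.2⟩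
  · by_cases h2 : ¬ (π + 12 < r₁ ∧ r₁ < π + 12 + 9) ∧ ¬ (π + 12 < r₂ ∧ r₂ < π + 12 + 9)
    · exact ⟨π + 12, Or.inr (Or.inl rfl), h2.1, h2.2⟩
    · refine ⟨π + 22, Or.inr (Or.inr rfl), ?_, ?_⟩ <;> omega

/-- the mirror image below `π`. -/
theorem exists_clean_zone_down (π r₁ r₂ : ℕ) (hπ : 40 ≤ π) :
    ∃ z : ℕ, (z = π - 11 ∨ z = π - 21 ∨ z = π - 31) ∧ ¬ (z < r₁ ∧ r₁ < z + 9) ∧ ¬ (z < r₂ ∧ r₂ < z + 9) := by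
  by_cases h1 : ¬ (π - 11 < r₁ ∧ r₁ < π - 11 + 9) ∧ ¬ (π - 11 < r₂ ∧ r₂ < π - 11 + 9)
  · exact ⟨π - 11, Or.inl rfl, h1.1, h1.2⟩
  · by_cases h2 : ¬ (π - 21 < r₁ ∧ r₁ < π - 21 + 9) ∧ ¬ (π - 21 < r₂ ∧ r₂ < π - 21 + 9)
    · exact ⟨π - 21, Or.inr (Or.inl rfl), h2.1, h2.2⟩
    · refine ⟨π - 31, Or.inr (Or.inr rfl), ?_, ?_⟩ <;> omega

/-- **ISOLATION (upper side)**: for `h` above `π` there is a clean zone `[z, z+9)` with `π + 2 ≤ z ≤ π + 22` avoiding `ρ_h, ρ_π`, and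
the four-term sum over the members of `pairSet` positioned above `z` vanishes at every input. -/
theorem far_sum_eq_zero_up (hup : sc.π + 128 ≤ sc.h) :
    ∃ z : ℕ, sc.π + 2 ≤ z ∧ z ≤ sc.π + 22 ∧ ¬ (z < sc.ρh ∧ sc.ρh < z + 9) ∧ ¬ (z < sc.ρπ ∧ sc.ρπ < z + 9) ∧
      ∀ x : Fin n → Bool, ∑ q ∈ (pairSet sc.S sc.π sc.h).filter (fun q => ¬ q.val ≤ z), fourTerm sc.S sc.π sc.h x q = 0 := by
  obtain ⟨z, hz, c1, c2⟩ := exists_clean_zone_up sc.π sc.ρh sc.ρπ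
  have hz1 : sc.π + 2 ≤ z ∧ z ≤ sc.π + 22 := by omega
  refine ⟨z, hz1.1, hz1.2, c1, c2, fun x => ?_⟩
  have hr := sc.room
  have hh := sc.h_bounds
  obtain ⟨F, hF⟩ := exists_zoneFlip (p := 5) (by norm_num) x z (by omega)
  have hF' : ZoneFlip 5 x F z 9 := hF
  have hsplit := fourTerm_sum_split (p := 5) (by norm_num) (by norm_num) sc.S hF' (by omega)
    (fun i hi => by have := (hF'.inside i hi); omega) (fun i hi => by have := (hF'.inside i hi); omega)
    (T := pairSet sc.S sc.π sc.h)
    (fun q hq => by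
      rcases sc.pos_of_mem_pairSet hq with e | e | e | e | e | e | e | e <;> omega)
    (fun q hq r hr => by
      rcases sc.read_of_mem hq hr with e | e | e | e <;> omega)
    (sum_fourTerm_eq_zero sc.S sc.πh2 sc.sym (Finset.Subset.refl _) x)
    (sum_fourTerm_eq_zero sc.S sc.πh2 sc.sym (Finset.Subset.refl _) _)
  exact hsplit.2

/-- **ISOLATION (lower side)**: for `h` below `π` there is a clean zone `[z, z+9)` with `π − 31 ≤ z ≤ π − 11` avoiding `ρ_h, ρ_π`,
and the four-term sum over the members of `pairSet` positioned at or below `z` vanishes at every input. -/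
theorem far_sum_eq_zero_down (hdown : sc.h + 128 ≤ sc.π) :
    ∃ z : ℕ, sc.π - 31 ≤ z ∧ z ≤ sc.π - 11 ∧ ¬ (z < sc.ρh ∧ sc.ρh < z + 9) ∧ ¬ (z < sc.ρπ ∧ sc.ρπ < z + 9) ∧
      ∀ x : Fin n → Bool, ∑ q ∈ (pairSet sc.S sc.π sc.h).filter (fun q => q.val ≤ z), fourTerm sc.S sc.π sc.h x q = 0 := by
  have hr := sc.room
  obtain ⟨z, hz, c1, c2⟩ := exists_clean_zone_down sc.π sc.ρh sc.ρπ (by omega)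
  have hz1 : sc.π - 31 ≤ z ∧ z ≤ sc.π - 11 := by omega
  refine ⟨z, hz1.1, hz1.2, c1, c2, fun x => ?_⟩
  have hh := sc.h_bounds
  obtain ⟨F, hF⟩ := exists_zoneFlip (p := 5) (by norm_num) x z (by omega)
  have hF' : ZoneFlip 5 x F z 9 := hF
  have hsplit := fourTerm_sum_split (p := 5) (by norm_num) (by norm_num) sc.S hF' (by omega)
    (fun i hi => by have := (hF'.inside i hi); omega) (fun i hi => by have := (hF'.inside i hi); omega)
    (T := pairSet sc.S sc.π sc.h)
    (fun q hq => by
      rcases sc.pos_of_mem_pairSet hq with e | e | e | e | e | e | e | e <;> omega)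
    (fun q hq r hr => by
      rcases sc.read_of_mem hq hr with e | e | e | e <;> omega)
    (sum_fourTerm_eq_zero sc.S sc.πh2 sc.sym (Finset.Subset.refl _) x)
    (sum_fourTerm_eq_zero sc.S sc.πh2 sc.sym (Finset.Subset.refl _) _)
  exact hsplit.1

end Scene

end RungU

end Summit.QuantumAdvantage.AdviceFreeQNC0.LocalEngine
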